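import Literature.NumberTheory.PAdicHodge.AinfWeierstrassTateModuleIntegersSS
import Literature.NumberTheory.PAdicHodge.AinfWeierstrassTateModuleGeom
import HarnessLib

/-!
# `T_p E(F̄) ≅ T_pŴ(𝒪_{ℂ_F})` as `Γ_F`-modules for a Weierstrass equation with coefficients in `𝒪_F` (the good model over a
# RAMIFIED base) with good supersingular reduction

Topic `Literature/NumberTheory/PAdicHodge`; namespace `Literature.NumberTheory.PAdicHodge.AinfTop`. The `𝒪_F`-coefficient twin of
`AinfWeierstrassTateModuleGeom` (case `W/ℤ`), on top of `AinfWeierstrassTateModuleIntegers(SS)` (the object `TatePtO F W p = T_pŴ(𝒪_{ℂ_F})`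
for `W : WeierstrassCurve (LTCoeff F)`, `LTCoeff F` = the discrete copy of `𝒪_F`, and the UNCONDITIONAL matching
`tateModuleCEquivTatePtOSS : T_p E(ℂ_F) ≃ T_pŴ(𝒪_{ℂ_F})` at good supersingular reduction). For `W` over `𝒪_F`, `E_F := W ⊗ F`
(`curveFO W`), `E(F̄) = geomPoints (curveFO W)` with its `Γ_F`-action (tree `GaloisAction`):

* `geomToCO W : E(F̄) →+ E(ℂ_F)` along `F̄ → ℂ_F` (`algClosureToC`), injective, **`Γ_F`-equivariant** (`geomToCO_smul`, with the
  coordinatewise action `galPointCO` on `E(ℂ_F)`), bijective on Tate modules (`tateGeomEquivCO`; torsion points are algebraic, tree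
  `TorsionPointsAlgebraic`);
* **`tateGeomEquivTatePtO : T_p E(F̄) ≃ₗ[ℤ_p] TatePtO F W p`** under `hss : E[pⁿ](ℂ_F) ⊂ E₁(ℂ_F)`, and its `Γ_F`-equivariance
  `tateGeomEquivTatePtO_galois` (it intertwines `galoisRepTate` with `tatePtORep`);
* **`tateGeomEquivTatePtOSS`**, **`tateGeomEquivTatePtOSS_galois`**: the same with `hss` DISCHARGED at good supersingular reduction
  (`Δ_W ∈ 𝒪_F^×`, `A_p(W mod 𝔪_F) = 0`, `p` odd = residue characteristic) — so the Galois representation on `T_pŴ(𝒪_{ℂ_F})`, on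
  which the ramified period maps `∫ω, ∫η` (files `AinfRamified*`) are defined, IS the `p`-adic Tate module of `E_F` restricted to `Γ_F`.

BSD context: route EdixhovenFibreFiveSeven, crux K★ `stmt-BirchSwinnertonDyer-22226`, road (R1) matching lane (M′) for the three
potentially supersingular additive cells (memo `Cruxes/StarredOptimalManinUnitFiveSeven/Lines/kato-lever-hDR-R1-models-descent.md` §6).
What is NOT here: the period maps, the socket. BSD / K★ are not proved by any of this.

## References
* J. H. Silverman, *The Arithmetic of Elliptic Curves* (2009), III.§7, Prop. VII.2.1–2.2. [SilvermanAEC2009]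
* J. Tate, *p-divisible groups* (1967), §4. [Tate1967]
-/

noncomputable section

open scoped Classical NNReal
open Field ValuativeRel

namespace Literature.NumberTheory.PAdicHodge

open Literature.NumberTheory.GaloisRepresentations
open Literature.NumberTheory.GaloisRepresentations.IsNonarchimedeanLocalField
open Literature.NumberTheory.GaloisRepresentations.LubinTate
open Literature.NumberTheory.EllipticCurves Literature.NumberTheory.EllipticCurves.FormalGroupChart

namespace AinfTop

variable {F : Type} [Field F] [ValuativeRel F] [TopologicalSpace F] [IsNonarchimedeanLocalField F] [CharZero F]
  (W : WeierstrassCurve (LTCoeff F)) {p : ℕ} [Fact p.Prime]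

/-! ## §1 `E(F̄) → E(ℂ_F)` for the `𝒪_F`-model -/

variable (F) in
/-- `E_F = W ⊗_{𝒪_F} F` for `W` over the discrete copy `LTCoeff F` of `𝒪_F`. [cite: SilvermanAEC2009, VII.§1] -/
abbrev curveFO : WeierstrassCurve F := W.map (algebraMap (LTCoeff F) F)

variable (F) in
/-- `E ⊗ F̄`. [cite: SilvermanAEC2009, III.§1] -/
abbrev curveBarO : WeierstrassCurve (AlgebraicClosure F) :=
  W.map ((algebraMap F (AlgebraicClosure F)).comp (algebraMap (LTCoeff F) F))

omit [TopologicalSpace F] [IsNonarchimedeanLocalField F] [CharZero F] [Fact p.Prime] in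
/-- `(W ⊗ F) ⊗ F̄ = W ⊗ F̄`. [cite: SilvermanAEC2009, III.§1] -/
theorem curveFO_baseChange : (curveFO F W).baseChange (AlgebraicClosure F) = curveBarO F W := by
  rw [WeierstrassCurve.baseChange, WeierstrassCurve.map_map]

omit [CharZero F] [Fact p.Prime] in
/-- `(W ⊗ F̄) ⊗ ℂ_F = W ⊗ ℂ_F` (`curveOver`): `F̄ → ℂ_F` restricted to `F` is `F → ℂ_F`, and `𝒪_F → 𝒪_{ℂ_F} → ℂ_F` is `𝒪_F ⊆ F → ℂ_F`.
[cite: SilvermanAEC2009, III.§1] -/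
theorem curveBarO_map_algClosureToC : (curveBarO F W).map (algClosureToC F) = curveOver (CompletedAlgClosure F) W := by
  rw [WeierstrassCurve.map_map, curveOver, ballIntModel, WeierstrassCurve.baseChange, WeierstrassCurve.map_map]
  exact congrArg W.map (RingHom.ext fun x => by
    rw [RingHom.comp_apply, RingHom.comp_apply, algClosureToC_algebraMap, RingHom.comp_apply]
    exact (coe_algebraMap_ltCoeff x).symm)

/-- **`E(F̄) →+ E(ℂ_F)`** along `F̄ → ℂ_F`, for the `𝒪_F`-model. [cite: SilvermanAEC2009, III.§7] -/
def geomToCO : (curveFO F W).geomPoints →+ (curveOver (CompletedAlgClosure F) W).toAffine.Point :=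
  (WeierstrassCurve.Affine.Point.congrEquiv (curveBarO_map_algClosureToC W)).toAddMonoidHom.comp
    (((curveBarO F W).mapPointHom (algClosureToC F)).comp
      (WeierstrassCurve.Affine.Point.congrEquiv (curveFO_baseChange W)).toAddMonoidHom)

omit [CharZero F] [Fact p.Prime] in
/-- `geomToCO` on coordinates: `(x, y) ↦ (ι x, ι y)`. [cite: SilvermanAEC2009, III.§7] -/
theorem geomToCO_some {x y : AlgebraicClosure F} (h : ((curveFO F W).baseChange (AlgebraicClosure F)).toAffine.Nonsingular x y) :
    ∃ h', geomToCO W (WeierstrassCurve.Affine.Point.some x y h : (curveFO F W).geomPoints) =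
      .some (algClosureToC F x) (algClosureToC F y) h' := by
  refine ⟨?_, ?_⟩
  · have h1 : (curveBarO F W).toAffine.Nonsingular x y := by rw [← curveFO_baseChange W]; exact h
    have h2 : ((curveBarO F W).map (algClosureToC F)).toAffine.Nonsingular (algClosureToC F x) (algClosureToC F y) :=
      (WeierstrassCurve.Affine.map_nonsingular _ (algClosureToC F).injective x y).mpr h1
    rwa [curveBarO_map_algClosureToC W] at h2
  · change WeierstrassCurve.Affine.Point.congrEquiv (curveBarO_map_algClosureToC W) ((curveBarO F W).mapPointHom (algClosureToC F)
      (WeierstrassCurve.Affine.Point.congrEquiv (curveFO_baseChange W) (.some x y h))) = _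
    rw [WeierstrassCurve.Affine.Point.congrEquiv_some, WeierstrassCurve.mapPointHom_some,
      WeierstrassCurve.Affine.Point.congrEquiv_some]

omit [CharZero F] [Fact p.Prime] in
/-- `geomToCO` is injective. [cite: SilvermanAEC2009, III.§7] -/
theorem geomToCO_injective : Function.Injective (geomToCO (F := F) W) :=
  (WeierstrassCurve.Affine.Point.congrEquiv (curveBarO_map_algClosureToC W)).injective.comp
    ((WeierstrassCurve.mapPointHom_injective _ _).comp (WeierstrassCurve.Affine.Point.congrEquiv (curveFO_baseChange W)).injective)

omit [CharZero F] [Fact p.Prime] in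
/-- **`geomToCO` is `Γ_F`-equivariant**: `ι(σ • P) = σ(ι P)` with the coordinatewise action `galPointCO` on `E(ℂ_F)`.
[cite: SilvermanAEC2009, III.§7] -/
theorem geomToCO_smul (σ : absoluteGaloisGroup F) (P : (curveFO F W).geomPoints) :
    geomToCO W (σ • P) = galPointCO W σ (geomToCO W P) := by
  set σ' : AlgebraicClosure F ≃ₐ[F] AlgebraicClosure F := σ with hσ'
  rcases P with _ | ⟨x, y, h⟩
  · change geomToCO W (σ • (0 : (curveFO F W).geomPoints)) = galPointCO W σ (geomToCO W 0)
    rw [smul_zero, map_zero, map_zero]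
  · obtain ⟨h', e⟩ := geomToCO_some W h
    change geomToCO W (WeierstrassCurve.Affine.Point.map (σ' : AlgebraicClosure F →ₐ[F] AlgebraicClosure F) (.some x y h)) = _
    rw [WeierstrassCurve.Affine.Point.map_some]
    obtain ⟨h'', e'⟩ := geomToCO_some W
      ((WeierstrassCurve.Affine.baseChange_nonsingular (W := curveFO F W)
        (f := (σ' : AlgebraicClosure F →ₐ[F] AlgebraicClosure F)) σ'.injective x y).mpr h)
    rw [e', e]
    obtain ⟨h3, e3⟩ := galPointHom_some (W := W) (CompletedAlgClosure.galRingHom σ) (galRingHom_cK_ltCoeff σ) h'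
    rw [galPointCO, e3]
    simp only [WeierstrassCurve.Affine.Point.some.injEq]
    refine ⟨?_, ?_⟩ <;>
    · rw [← CompletedAlgClosure.smul_def, smul_algClosureToC]; rfl

/-! ## §2 The Tate modules -/

omit [TopologicalSpace F] [IsNonarchimedeanLocalField F] [CharZero F] [Fact p.Prime] in
/-- `W ⊗ F̄` is an elliptic curve when `Δ_W ∈ 𝒪_F^×`. [cite: SilvermanAEC2009, III.§1] -/
theorem isElliptic_curveBarO (hΔ : IsUnit W.Δ) : (curveBarO F W).IsElliptic :=
  ⟨by rw [WeierstrassCurve.map_Δ]; exact hΔ.map _⟩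

omit [TopologicalSpace F] [IsNonarchimedeanLocalField F] [CharZero F] [Fact p.Prime] in
/-- `W ⊗ F` is an elliptic curve when `Δ_W ∈ 𝒪_F^×`. [cite: SilvermanAEC2009, III.§1] -/
theorem isElliptic_curveFO (hΔ : IsUnit W.Δ) : (curveFO F W).IsElliptic :=
  ⟨by rw [WeierstrassCurve.map_Δ]; exact hΔ.map _⟩

variable (F p) in
/-- **`T_p E(F̄) ≃ₗ[ℤ_p] T_p E(ℂ_F)`** for the `𝒪_F`-model (`p`-power torsion points of `E(ℂ_F)` are algebraic).
[cite: SilvermanAEC2009, III.§7] -/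
def tateGeomEquivCO (hΔ : IsUnit W.Δ) :
    (curveFO F W).tateModule p ≃ₗ[ℤ_[p]] TateModule (curveOver (CompletedAlgClosure F) W).toAffine.Point p :=
  haveI := isElliptic_curveBarO (F := F) W hΔ
  haveI : CharZero (AlgebraicClosure F) := charZero_of_injective_algebraMap (algebraMap F (AlgebraicClosure F)).injective
  (TateModule.mapEquiv p (WeierstrassCurve.Affine.Point.congrEquiv (curveFO_baseChange W))).trans
    ((tateModuleMapEquiv (algClosureToC F) (curveBarO F W) p (Nat.cast_ne_zero.mpr (Fact.out : p.Prime).ne_zero)).trans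
      (TateModule.mapEquiv p (WeierstrassCurve.Affine.Point.congrEquiv (curveBarO_map_algClosureToC W))))

/-- Components of `tateGeomEquivCO`: `geomToCO` on each level. [cite: SilvermanAEC2009, III.§7] -/
theorem proj_tateGeomEquivCO (hΔ : IsUnit W.Δ) (τ : (curveFO F W).tateModule p) (n : ℕ) :
    TateModule.proj p n (tateGeomEquivCO F W p hΔ τ) = geomToCO W (TateModule.proj p n τ) := by
  rfl

/-- `tateGeomEquivCO (σ • τ) = T_p(σ) (tateGeomEquivCO τ)`. [cite: SilvermanAEC2009, III.§7] -/
theorem tateGeomEquivCO_smul (hΔ : IsUnit W.Δ) (σ : absoluteGaloisGroup F) (τ : (curveFO F W).tateModule p) :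
    tateGeomEquivCO F W p hΔ (σ • τ) = TateModule.map p (galPointCO W σ) (tateGeomEquivCO F W p hΔ τ) :=
  TateModule.ext fun n => by
    rw [proj_tateGeomEquivCO, TateModule.proj_map, proj_tateGeomEquivCO, TateModule.proj_smul_of_distribMulAction]
    exact geomToCO_smul W σ _

variable (F p) in
/-- **`T_p E(F̄) ≃ₗ[ℤ_p] T_pŴ(𝒪_{ℂ_F}) = TatePtO F W p`** for the `𝒪_F`-model when every `p`-power torsion point of `E(ℂ_F)` lies in
`E₁(ℂ_F)`: the geometric Tate module is the Tate module of the formal group. [cite: SilvermanAEC2009, Prop. VII.2.2] [cite: Tate1967, §4] -/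
def tateGeomEquivTatePtO (hΔ : IsUnit W.Δ)
    (hss : ∀ (n : ℕ) (P : (curveOver (CompletedAlgClosure F) W).toAffine.Point), p ^ n • P = 0 →
      P ∈ @kernel _ _ (NormedField.valuation (K := CompletedAlgClosure F)) (curveOver (CompletedAlgClosure F) W)
        (isIntegral_curveOver _ _)) :
    (curveFO F W).tateModule p ≃ₗ[ℤ_[p]] TatePtO F W p :=
  haveI := isElliptic_curveOverC_O (F := F) hΔ
  (tateGeomEquivCO F W p hΔ).trans (tateModuleCEquivTatePtO F W p hss)

/-- **`Γ_F`-equivariance of the matching `T_p E(F̄) ≅ T_pŴ(𝒪_{ℂ_F})`** (`𝒪_F`-model): `galoisRepTate σ` on the left is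
`tatePtORep σ` on the right. [cite: SilvermanAEC2009, III.§7] [cite: Tate1967, §4] -/
theorem tateGeomEquivTatePtO_galois (hΔ : IsUnit W.Δ)
    (hss : ∀ (n : ℕ) (P : (curveOver (CompletedAlgClosure F) W).toAffine.Point), p ^ n • P = 0 →
      P ∈ @kernel _ _ (NormedField.valuation (K := CompletedAlgClosure F)) (curveOver (CompletedAlgClosure F) W)
        (isIntegral_curveOver _ _))
    (σ : absoluteGaloisGroup F) (τ : (curveFO F W).tateModule p) :
    tateGeomEquivTatePtO F W p hΔ hss ((curveFO F W).galoisRepTate p σ τ) =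
      tatePtORep F W p σ (tateGeomEquivTatePtO F W p hΔ hss τ) := by
  haveI := isElliptic_curveOverC_O (F := F) hΔ
  rw [WeierstrassCurve.galoisRepTate_apply_apply, tatePtORep_apply_apply]
  change tateModuleCEquivTatePtO F W p hss (tateGeomEquivCO F W p hΔ (σ • τ)) =
    σ • tateModuleCEquivTatePtO F W p hss (tateGeomEquivCO F W p hΔ τ)
  rw [tateGeomEquivCO_smul, tateModuleCEquivTatePtO_galois]

/-! ## §3 Good supersingular reduction: the matching is unconditional -/

variable (F p) in
/-- **`T_p E(F̄) ≃ₗ[ℤ_p] T_pŴ(𝒪_{ℂ_F})` for the `𝒪_F`-model, UNCONDITIONALLY at good supersingular reduction** (`Δ_W ∈ 𝒪_F^×`,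
`A_p(W mod 𝔪_F) = 0`, `p` odd = residue characteristic): `E[p^∞](ℂ_F) ⊂ E₁(ℂ_F)` by `mem_kernel_of_pow_prime_smul_eq_zero_ssO`.
[cite: SilvermanAEC2009, Prop. VII.2.1–2.2] [cite: Tate1967, §4] -/
def tateGeomEquivTatePtOSS [CharP 𝓀[F] p] (hp2 : p ≠ 2) (hΔ : IsUnit W.Δ) (hA : (W.map (redCoeff F)).hasseCoeff p = 0) :
    (curveFO F W).tateModule p ≃ₗ[ℤ_[p]] TatePtO F W p :=
  tateGeomEquivTatePtO F W p hΔ (mem_kernel_of_pow_prime_smul_eq_zero_ssO hp2 hΔ hA)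

/-- **`Γ_F`-equivariance** of `tateGeomEquivTatePtOSS`: `galoisRepTate σ ↦ tatePtORep σ`. [cite: SilvermanAEC2009, III.§7]
[cite: Tate1967, §4] -/
theorem tateGeomEquivTatePtOSS_galois [CharP 𝓀[F] p] (hp2 : p ≠ 2) (hΔ : IsUnit W.Δ) (hA : (W.map (redCoeff F)).hasseCoeff p = 0)
    (σ : absoluteGaloisGroup F) (τ : (curveFO F W).tateModule p) :
    tateGeomEquivTatePtOSS F W p hp2 hΔ hA ((curveFO F W).galoisRepTate p σ τ) =
      tatePtORep F W p σ (tateGeomEquivTatePtOSS F W p hp2 hΔ hA τ) :=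
  tateGeomEquivTatePtO_galois W hΔ _ σ τ

/-- The same equivariance with both actions written as `•`. [cite: Tate1967, §4] -/
theorem tateGeomEquivTatePtOSS_smul [CharP 𝓀[F] p] (hp2 : p ≠ 2) (hΔ : IsUnit W.Δ) (hA : (W.map (redCoeff F)).hasseCoeff p = 0)
    (σ : absoluteGaloisGroup F) (τ : (curveFO F W).tateModule p) :
    tateGeomEquivTatePtOSS F W p hp2 hΔ hA (σ • τ) = σ • tateGeomEquivTatePtOSS F W p hp2 hΔ hA τ := by
  have h := tateGeomEquivTatePtOSS_galois W hp2 hΔ hA σ τ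
  rwa [WeierstrassCurve.galoisRepTate_apply_apply, tatePtORep_apply_apply] at h

end AinfTop

end Literature.NumberTheory.PAdicHodge

end
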